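import Summits.ResolutionOfSingularities.ResolutionOfSingularities.Theorems.WeightedInvariantSuccessorRatioBoundChart
import HarnessLib

/-!
# (o56)(b′) ring side, PART 5 of 6 — the DOOR HELPERS (frame translations), the LAYER DATA (D2) from the chart pull-back, and the ring side
# OVER A CHART MODEL: `layerData_of_chart`, `oneFlagRatioBound_of_chart`, `successorRatioBound_of_chart`

**Provenance / honest framing.** This is a VERBATIM PORT (proofs unchanged; namespace `…LocalEngine.Iota3.RatContact` instead of the sketch's
`…Iota3.R9`) of res-L1-w43-idea-2's kernel-checked sketch `Cruxes/WeightedConstruction/SketchL1w43Idea2R9.lean` (Sketch-R9, gen 9, tree copy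
b7197eb188e64d8c = 657de2227c79926d + the §15 unit-factor lemma; §14e as announced f30a0aee35c844fc), board item (o56-R9) of res-L1-w43-plan-1 (dealer word STATUS l.69360), res-plan-2 IDLE POOL
DEAL #52 (2); ported by res-L1-type-o4 so that `Theorems/` files (res-type-057's (D1) bundle for the door item `stmt-ResolutionOfSingularities-19897`
branch (o56)(b′)) can import it; `--supports stmt-ResolutionOfSingularities-0571 --as helper`. [OURS · L1 w43 · idea-2 R9] Every statement here is OURS
elementary commutative algebra over Mathlib and the tree's `flagContactFiltration` / `weightedMonomialIdeal` / unit-expansion calculus; every `def` is an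
OURS notion of the sketch (NOT a statement of H. Hironaka's 2017 manuscript, which is under adjudication and is neither asserted nor used); no Literature
fact is introduced; AI-written and AI-ported, weaker than expert review; nothing here is progress on resolution of singularities in positive characteristic.

## Contents (Sketch-R9 §13, §14c, §14d verbatim)
§13 DOOR HELPERS: `weightedMonomialIdeal_update_add_mul_pow_eq` / `tauFrame_translate_eq` (weight-`≥` translation `uᵢ ↦ uᵢ + c·uⱼ^e` keeps every
`W(·;n)`), `order_drops_over_eta_arith`, `add_pow_sub_pow_mem_weightedMonomialIdeal` / `layer_transport` (strict translations keep layers);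
§14c `layerData_of_chart` (when `ν` persists at the successor: the degree-`ν` layer of `f₁` is `{Y^ν} ∪ t·(…)` with a unit at `Y^ν`), and
`oneFlagRatioBound_of_chart` / `successorRatioBound_of_chart` = (b′)'s ring side from a chart model `φ : S → T` plus an `S`-side EXPANSION ORACLE.
-/

noncomputable section

open IsLocalRing Literature.AlgebraicGeometry.Resolution

set_option linter.dupNamespace false

namespace Summit.ResolutionOfSingularities.ResolutionOfSingularities.Cruxes.HypersurfaceCentreConstruction.LocalEngine

namespace Iota3

namespace RatContact

/-! ## §13 (gen 9, R9.12) Two helpers for the door's obligation (D3) and for axis (i) of ORDER (o64)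

(a) `weightedMonomialIdeal_update_add_mul_pow_eq`: translating a frame element by a multiple of a POWER of another
frame element, of weight `≥` its own weight, changes no piece of the weighted filtration — the door's S-frame change
`y ↦ y - c·x^(b+1)` with weights `(q, r+1, 1)` and `r + 1 ≤ q·(b+1)`, so the rigid `τ(η) = 0` test transports
between the `δ_η`-prepared frames at the various closed points of `C` (jets lemma [Wlodarczyk2022, 2.1.12] as
typed in `Theorems.weightedMonomialIdeal_eq_of_forall_sub_mem`; compare the transvection-by-a-parameter form
`Theorems.weightedMonomialIdeal_update_add_mul_eq`).
(b) `order_drops_over_eta_arith`: the exponent arithmetic of the lemma «over the generic point `η` of `C` the order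
always drops» (R9.12 (C), case `q ≥ 2`): a `δ`-face monomial, `q·i = r·m` with `m = ν - j > 0`, `r = q·b + ρ`,
`ρ < q`, has `x`-chart exponent `i - b·m < m`, whence `ord_{η₁} f₁ ≤ (i - b·m) + j < ν`. -/

section DoorHelpers

/-- [OURS · L1 w43 · R9.12 (a)] Weight-`≥` translation by a power preserves the weighted filtration. -/
theorem weightedMonomialIdeal_update_add_mul_pow_eq {A : Type*} [CommRing A] {m : ℕ} (u : Fin m → A)
    (w : Fin m → ℕ) {i j : Fin m} (hij : i ≠ j) (c : A) (e : ℕ) (hw : w i ≤ w j * e) (n : ℕ) :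
    weightedMonomialIdeal (Function.update u i (u i + c * u j ^ e)) w n = weightedMonomialIdeal u w n := by
  have hj : Function.update u i (u i + c * u j ^ e) j = u j := Function.update_of_ne hij.symm _ _
  refine Theorems.weightedMonomialIdeal_eq_of_forall_sub_mem u _ w (fun l => ?_) (fun l => ?_) n
  · by_cases hl : l = i
    · subst hl
      rw [Function.update_self, add_sub_cancel_left]
      exact Ideal.mul_mem_left _ _ (weightedMonomialIdeal_antitone u w hw
        (Theorems.pow_mem_weightedMonomialIdeal u w (Theorems.self_mem_weightedMonomialIdeal u w j) e))
    · rw [Function.update_of_ne hl, sub_self]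
      exact Ideal.zero_mem _
  · by_cases hl : l = i
    · subst hl
      rw [Function.update_self, sub_add_cancel_left]
      have h := Theorems.pow_mem_weightedMonomialIdeal _ w
        (Theorems.self_mem_weightedMonomialIdeal (Function.update u l (u l + c * u j ^ e)) w j) e
      rw [hj] at h
      exact neg_mem (Ideal.mul_mem_left _ _ (weightedMonomialIdeal_antitone _ w hw h))
    · rw [Function.update_of_ne hl, sub_self]
      exact Ideal.zero_mem _

/-- [OURS · L1 w43 · R9.12 (a′)] The door's instance: in an S-frame `(x, y, z)` with weights `(q, r+1, 1)` and
`r + 1 ≤ q·(b+1)`, the translation `y ↦ y + c·x^(b+1)` changes no piece `W((x,y,z); (q,r+1,1); n)`; in particular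
the rigid `τ = 0` reading `f ∉ W(…; (r+1)·ν)` is the same in both frames. -/
theorem tauFrame_translate_eq {A : Type*} [CommRing A] (x y z c : A) {q r b : ℕ} (h : r + 1 ≤ q * (b + 1))
    (n : ℕ) :
    weightedMonomialIdeal ![x, y + c * x ^ (b + 1), z] ![q, r + 1, 1] n =
      weightedMonomialIdeal ![x, y, z] ![q, r + 1, 1] n := by
  have := weightedMonomialIdeal_update_add_mul_pow_eq ![x, y, z] ![q, r + 1, 1] (i := 1) (j := 0)
    (by decide) c (b + 1) (by simpa using h) n
  convert this using 2
  ext l; fin_cases l <;> simp [Function.update]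

/-- [OURS · L1 w43 · R9.12 (b)] Exponent arithmetic of «the order drops over `η`» (`q ≥ 2` case). -/
theorem order_drops_over_eta_arith {q r b ρ i m : ℕ} (hr : r = q * b + ρ) (hρq : ρ < q) (hm : 0 < m)
    (hface : q * i = r * m) : b * m ≤ i ∧ i - b * m < m := by
  subst hr
  have hq : 0 < q := lt_of_le_of_lt (Nat.zero_le ρ) hρq
  have hbm : b * m ≤ i := by
    by_contra hlt
    have hlt' : i < b * m := Nat.lt_of_not_le hlt
    have : q * i < q * (b * m) := Nat.mul_lt_mul_of_pos_left hlt' hq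
    nlinarith
  refine ⟨hbm, ?_⟩
  obtain ⟨d, rfl⟩ := Nat.exists_eq_add_of_le hbm
  have hd : q * d = ρ * m := by nlinarith
  have : q * d < q * m := by rw [hd]; exact Nat.mul_lt_mul_of_pos_right hρq hm
  simpa using Nat.lt_of_mul_lt_mul_left this

/-- [OURS · L1 w43 · R9.12 (c)] Binomial estimate in the weighted filtration: if `X ∈ W_s` and `D ∈ W_{s+1}` then
`(X + D)^n - X^n ∈ W_{s·n+1}` — every cross term carries at least one factor `D`. [folklore] -/
theorem add_pow_sub_pow_mem_weightedMonomialIdeal {A : Type*} [CommRing A] {m : ℕ} (u : Fin m → A)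
    (w : Fin m → ℕ) {s : ℕ} {X D : A} (hX : X ∈ weightedMonomialIdeal u w s)
    (hD : D ∈ weightedMonomialIdeal u w (s + 1)) (n : ℕ) :
    (X + D) ^ n - X ^ n ∈ weightedMonomialIdeal u w (s * n + 1) := by
  induction n with
  | zero => simp
  | succ n ih =>
    have hXD : X + D ∈ weightedMonomialIdeal u w s :=
      add_mem hX (weightedMonomialIdeal_antitone u w (Nat.le_succ s) hD)
    have h1 : (X + D) * ((X + D) ^ n - X ^ n) ∈ weightedMonomialIdeal u w (s + (s * n + 1)) :=
      Theorems.weightedMonomialIdeal_mul_le u w _ _ (Ideal.mul_mem_mul hXD ih)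
    have h2 : D * X ^ n ∈ weightedMonomialIdeal u w ((s + 1) + s * n) :=
      Theorems.weightedMonomialIdeal_mul_le u w _ _
        (Ideal.mul_mem_mul hD (Theorems.pow_mem_weightedMonomialIdeal u w hX n))
    have e : (X + D) ^ (n + 1) - X ^ (n + 1) = (X + D) * ((X + D) ^ n - X ^ n) + D * X ^ n := by ring
    rw [e]
    refine add_mem ?_ ?_
    · simpa [Nat.mul_succ, Nat.add_comm, Nat.add_left_comm, Nat.add_assoc] using h1
    · simpa [Nat.mul_succ, Nat.add_comm, Nat.add_left_comm, Nat.add_assoc] using h2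

/-- [OURS · L1 w43 · R9.12 (c′)] **Layer transport under a weight-raising translation** — the door's (D2)/(D3)
support-level transport done ring-side: if `uᵢ` is replaced by `uᵢ + c·uⱼ^e` with `wᵢ + 1 ≤ wⱼ·e` (STRICTLY
heavier), then a homogeneous layer `Σ_{α ∈ Δ} a_α u^α` of weight `n` differs from the SAME layer written in the new
frame by an element of `W_{n+1}`: the `δ`-face (its exponent set `Δ` and its coefficients) is literally the same in
the translated frame `y ↦ y + c·x^(b+1)` (`q(b+1) ≥ r + 1`). -/
theorem layer_transport {A : Type*} [CommRing A] {m : ℕ} (u : Fin m → A) (w : Fin m → ℕ) {i j : Fin m}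
    (c : A) (e : ℕ) (hw : w i + 1 ≤ w j * e) (Δ : Finset (Fin m → ℕ)) (a : (Fin m → ℕ) → A)
    {n : ℕ} (hΔ : ∀ α ∈ Δ, ∑ l, w l * α l = n) :
    (∑ α ∈ Δ, a α * ∏ l, u l ^ α l) -
        ∑ α ∈ Δ, a α * ∏ l, Function.update u i (u i + c * u j ^ e) l ^ α l ∈
      weightedMonomialIdeal u w (n + 1) := by
  classical
  set u' := Function.update u i (u i + c * u j ^ e) with hu'
  rw [← Finset.sum_sub_distrib]
  refine Ideal.sum_mem _ (fun α hα => ?_)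
  rw [← mul_sub]
  refine Ideal.mul_mem_left _ _ ?_
  -- split both monomials at the coordinate `i`
  have hR : ∀ v : Fin m → A, ∏ l, v l ^ α l = v i ^ α i * ∏ l ∈ Finset.univ.erase i, v l ^ α l :=
    fun v => (Finset.mul_prod_erase Finset.univ (fun l => v l ^ α l) (Finset.mem_univ i)).symm
  have hR' : ∏ l ∈ Finset.univ.erase i, u' l ^ α l = ∏ l ∈ Finset.univ.erase i, u l ^ α l :=
    Finset.prod_congr rfl (fun l hl => by rw [hu', Function.update_of_ne (Finset.ne_of_mem_erase hl)])
  rw [hR u, hR u', hR', ← sub_mul, hu', Function.update_self]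
  -- weight of the common factor
  set r := ∑ l ∈ Finset.univ.erase i, w l * α l with hr
  have hn : w i * α i + r = n := by
    rw [← hΔ α hα, hr, ← Finset.add_sum_erase Finset.univ (fun l => w l * α l) (Finset.mem_univ i)]
  have hRmem : ∏ l ∈ Finset.univ.erase i, u l ^ α l ∈ weightedMonomialIdeal u w r := by
    have h := Theorems.prod_pow_mem_weightedMonomialIdeal u w (Function.update α i 0) (le_refl _)
    have hp : ∏ l, u l ^ Function.update α i 0 l = ∏ l ∈ Finset.univ.erase i, u l ^ α l := by
      rw [← Finset.mul_prod_erase Finset.univ (fun l => u l ^ Function.update α i 0 l) (Finset.mem_univ i),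
        Function.update_self, pow_zero, one_mul]
      exact Finset.prod_congr rfl (fun l hl => by rw [Function.update_of_ne (Finset.ne_of_mem_erase hl)])
    have hs : ∑ l, w l * Function.update α i 0 l = r := by
      rw [← Finset.add_sum_erase Finset.univ (fun l => w l * Function.update α i 0 l) (Finset.mem_univ i),
        Function.update_self, mul_zero, zero_add, hr]
      exact Finset.sum_congr rfl (fun l hl => by rw [Function.update_of_ne (Finset.ne_of_mem_erase hl)])
    rw [hp, hs] at h
    exact h
  -- the binomial estimate at coordinate `i`
  have hX : u i ∈ weightedMonomialIdeal u w (w i) := Theorems.self_mem_weightedMonomialIdeal u w i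
  have hD : c * u j ^ e ∈ weightedMonomialIdeal u w (w i + 1) :=
    Ideal.mul_mem_left _ _ (weightedMonomialIdeal_antitone u w hw
      (Theorems.pow_mem_weightedMonomialIdeal u w (Theorems.self_mem_weightedMonomialIdeal u w j) e))
  have hB := add_pow_sub_pow_mem_weightedMonomialIdeal u w hX hD (α i)
  have hprod := Theorems.weightedMonomialIdeal_mul_le u w _ _ (Ideal.mul_mem_mul (neg_mem hB) hRmem)
  have e1 : -((u i + c * u j ^ e) ^ α i - u i ^ α i) = u i ^ α i - (u i + c * u j ^ e) ^ α i := by ring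
  rw [e1] at hprod
  have e2 : w i * α i + 1 + r = n + 1 := by omega
  rw [e2] at hprod
  exact hprod

end DoorHelpers

section ChartPullback

variable {S T : Type*} [CommRing S] [IsLocalRing S] [CommRing T] [IsRegularLocalRing T]

/-! ### §14c The LAYER DATA (D2) of `successorRatioBound_of_lowWitnesses` from the same pull-back.  When `ν` persists at the
successor point (`f₁ ∈ 𝔪_T^ν` — otherwise the invariant drops at the first letter and (b′) is not invoked), the degree-`ν` layer of
the pulled-back unit expansion is `{Y^ν} ∪ {monomials divisible by t}` with a unit at `Y^ν`: `Y^ν` is the image of `y^ν`, and a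
`t`-free degree-`ν` successor monomial comes from an exponent ON the cylinder boundary `α₀ + bα₁ = bν`, which `δ_η`-preparedness
(`r(ν−α₁) ≤ qα₀`, `r = qb + ρ`, `ρ ≥ 1`) forces to be `y^ν` itself. -/

/-- [OURS · L1 w43 · R9 §14c] (D2) from the chart: the layer data `hΔ, hα₀, ha₀, htfree, hf` of
`successorRatioBound_of_lowWitnesses`, in the frame `(t, φ z, Y)`, from a unit expansion of `f` in `S` that is cylinder-or-deep and
prepared-or-deep and contains `y^ν`, for any model `φ` of the chart, provided `ν` persists (`f₁ ∈ 𝔪_T^ν`). -/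
theorem layerData_of_chart (φ : S →+* T) (hdimT : ringKrullDim T = (3 : ℕ)) {x y z : S} {t Y : T}
    (h𝔪T : Ideal.span (Set.range ![t, φ z, Y]) = maximalIdeal T) {b ν M q r ρ : ℕ} (hx : φ x = t)
    (hy : φ y = t ^ b * Y) (hφ : Ideal.map φ (maximalIdeal S) ≤ maximalIdeal T) (ht2 : t ∉ maximalIdeal T ^ 2)
    (hz : z ∈ maximalIdeal S) (hρ : 0 < ρ) (hr : r = q * b + ρ) {Δ : Finset (Fin 3 → ℕ)} {a : (Fin 3 → ℕ) → S}
    {f : S} {f₁ : T} (hunit : ∀ α ∈ Δ, IsUnit (a α))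
    (hrem : f - ∑ α ∈ Δ, a α * ∏ i, ![x, y, z] i ^ α i ∈ maximalIdeal S ^ M) (hM : ν + 1 + b * ν ≤ M)
    (hcyl : ∀ α ∈ Δ, b * ν ≤ α 0 + b * α 1 ∨ M ≤ α 2) (hprep : ∀ α ∈ Δ, r * (ν - α 1) ≤ q * α 0 ∨ M ≤ α 2)
    (hyν : (![0, ν, 0] : Fin 3 → ℕ) ∈ Δ) (hf₁ : φ f = t ^ (b * ν) * f₁) (hpers : f₁ ∈ maximalIdeal T ^ ν) :
    ∃ (ΔT : Finset (Fin 3 → ℕ)) (aT : (Fin 3 → ℕ) → T), (∀ e ∈ ΔT, ∑ i, e i = ν) ∧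
      (![0, 0, ν] : Fin 3 → ℕ) ∈ ΔT ∧ IsUnit (aT ![0, 0, ν]) ∧ (∀ e ∈ ΔT, e 0 = 0 → e = ![0, 0, ν]) ∧
      f₁ - ∑ e ∈ ΔT, aT e * ∏ i, ![t, φ z, Y] i ^ e i ∈ maximalIdeal T ^ (ν + 1) := by
  classical
  set Δg := Δ.filter (fun α => b * ν ≤ α 0 + b * α 1) with hΔg
  have hpb := chart_pullback_expansion_of_deep φ hx hy hφ ht2 hz hrem hcyl hf₁
  rw [← hΔg] at hpb
  have hcylg : ∀ α ∈ Δg, b * ν ≤ α 0 + b * α 1 := fun α hα => (Finset.mem_filter.mp hα).2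
  -- re-indexing by `chartExp`, injective on the cylinder part
  let inv : (Fin 3 → ℕ) → (Fin 3 → ℕ) := fun e => ![e 0 + b * ν - b * e 2, e 2, e 1]
  have hinv : ∀ α ∈ Δg, inv (chartExp b ν α) = α := by
    intro α hα
    have := hcylg α hα
    ext i
    fin_cases i
    · show chartExp b ν α 0 + b * ν - b * chartExp b ν α 2 = α 0
      simp only [chartExp_zero, chartExp_two]; omega
    · show chartExp b ν α 2 = α 1
      simp
    · show chartExp b ν α 1 = α 2
      simp
  have hinj : Set.InjOn (chartExp b ν) (Δg : Set (Fin 3 → ℕ)) := by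
    intro α hα β hβ h
    rw [← hinv α hα, ← hinv β hβ, h]
  set Δ' := Δg.image (chartExp b ν) with hΔ'
  let c' : (Fin 3 → ℕ) → T := fun e => φ (a (inv e))
  have hunit' : ∀ e ∈ Δ', IsUnit (c' e) := by
    intro e he
    obtain ⟨α, hα, rfl⟩ := Finset.mem_image.mp he
    show IsUnit (φ (a (inv (chartExp b ν α))))
    rw [hinv α hα]
    exact (hunit α (Finset.mem_filter.mp hα).1).map φ
  have hs : ∑ e ∈ Δ', c' e * ∏ i, ![t, φ z, Y] i ^ e i =
      ∑ α ∈ Δg, φ (a α) * ∏ i, ![t, φ z, Y] i ^ chartExp b ν α i := by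
    rw [hΔ', Finset.sum_image hinj]
    exact Finset.sum_congr rfl (fun α hα => by show φ (a (inv (chartExp b ν α))) * _ = _; rw [hinv α hα])
  have hr' : f₁ - ∑ e ∈ Δ', c' e * ∏ i, ![t, φ z, Y] i ^ e i ∈ maximalIdeal T ^ (ν + 1) := by
    rw [hs]
    exact Ideal.pow_le_pow_right (by omega) hpb
  -- reading in `T`: `ν` persists ⇒ every successor exponent has degree `≥ ν`
  have hdeg : ∀ e ∈ Δ', ν ≤ ∑ i, e i := by
    have hpers' : f₁ ∈ weightedMonomialIdeal ![t, φ z, Y] (fun _ => 1) ν := by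
      rw [Theorems.LocalGameEFTNewton.weightedMonomialIdeal_const_one_eq_pow ![t, φ z, Y] h𝔪T]
      exact hpers
    have h := Theorems.LocalGameEFTNewton.le_weight_of_mem_weightedMonomialIdeal ![t, φ z, Y] h𝔪T hdimT (fun _ => 1)
      (fun _ => one_pos) hunit' hr' hpers' (Nat.le_succ ν)
    intro e he
    simpa using h e he
  -- the layer
  refine ⟨Δ'.filter (fun e => ∑ i, e i = ν), c', fun e he => (Finset.mem_filter.mp he).2, ?_, ?_, ?_, ?_⟩
  · -- `Y^ν = chartExp (y^ν)`
    have hyg : (![0, ν, 0] : Fin 3 → ℕ) ∈ Δg := Finset.mem_filter.mpr ⟨hyν, by simp⟩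
    have he : chartExp b ν ![0, ν, 0] = ![0, 0, ν] := by
      ext i; fin_cases i <;> simp [chartExp]
    refine Finset.mem_filter.mpr ⟨?_, by simp [Fin.sum_univ_three]⟩
    rw [← he]
    exact Finset.mem_image_of_mem _ hyg
  · show IsUnit (φ (a (inv ![0, 0, ν])))
    have : inv ![0, 0, ν] = ![0, ν, 0] := by
      ext i; fin_cases i <;> simp [inv]
    rw [this]
    exact (hunit _ hyν).map φ
  · intro e he he0
    obtain ⟨he', hdeg'⟩ := Finset.mem_filter.mp he
    obtain ⟨α, hα, rfl⟩ := Finset.mem_image.mp he'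
    obtain ⟨hαΔ, hcα⟩ := Finset.mem_filter.mp hα
    simp only [chartExp_zero] at he0
    rw [Fin.sum_univ_three, chartExp_zero, chartExp_one, chartExp_two] at hdeg'
    have hα2 : α 2 < M := by omega
    have hp : r * (ν - α 1) ≤ q * α 0 := (hprep α hαΔ).resolve_right (by omega)
    have hα1 : α 1 ≤ ν := by omega
    obtain ⟨m, hm⟩ := Nat.exists_eq_add_of_le hα1
    have hm' : ν - α 1 = m := by omega
    rw [hm'] at hp
    have hbν : b * ν = b * α 1 + b * m := by rw [hm, mul_add]
    have hα0 : α 0 = b * m := by omega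
    rw [hr, hα0, add_mul] at hp
    have hρm : ρ * m = 0 := by
      have : q * b * m + ρ * m ≤ q * b * m := by
        calc q * b * m + ρ * m ≤ q * (b * m) := hp
          _ = q * b * m := by ring
      omega
    have hm0 : m = 0 := by
      rcases Nat.mul_eq_zero.mp hρm with h | h
      · omega
      · exact h
    ext i
    fin_cases i
    · show chartExp b ν α 0 = 0
      exact he0
    · show chartExp b ν α 1 = 0
      rw [chartExp_one]; omega
    · show chartExp b ν α 2 = ν
      rw [chartExp_two]; omega
  · -- the rest of `Δ'` has degree `≥ ν + 1`
    have hrest : ∑ e ∈ Δ'.filter (fun e => ¬ ∑ i, e i = ν), c' e * ∏ i, ![t, φ z, Y] i ^ e i ∈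
        maximalIdeal T ^ (ν + 1) := by
      refine Ideal.sum_mem _ (fun e he => ?_)
      obtain ⟨he', hne⟩ := Finset.mem_filter.mp he
      have hge : ν + 1 ≤ ∑ i, e i := by have := hdeg e he'; omega
      exact Ideal.mul_mem_left _ _ (Ideal.pow_le_pow_right hge
        (Theorems.LocalGameEFTNewton.prod_pow_mem_pow ![t, φ z, Y] h𝔪T e))
    have hsplit := Finset.sum_filter_add_sum_filter_not Δ' (fun e => ∑ i, e i = ν)
      (fun e => c' e * ∏ i, ![t, φ z, Y] i ^ e i)
    have h := Ideal.add_mem _ hr' hrest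
    rw [← hsplit] at h
    convert h using 1
    ring

/-! ### §14d THE RING SIDE OF (o56)(b′) OVER A CHART MODEL — one theorem.  Input: a model `φ : S → T` of the `x`-chart at the
successor point (four equations), residue representatives `Λ_S ⊆ S`, persistence of `ν`, and an EXPANSION ORACLE on the `S` side:
for every `c ∈ S` and every precision `M`, ONE unit expansion of `f` in the frame `(x, y − c·x^{b+1}, z)` mod `𝔪_S^M` that is
cylinder-or-deep, prepared-or-deep, contains `y'^ν`, and has a prepared `τ = 0` witness — exactly what the three positive-weight
readings of §14b give from the three frame facts of §13.  Output: `SuccessorRatioBound T f₁ ν q ρ`.  No statement about `T` beyond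
regularity, dimension 3 and the frame `(t, φ z, Y)`. -/

/-- [OURS · L1 w43 · R9 §14d · CANDIDATE-FREE] **(b′) over a chart model.** -/
theorem oneFlagRatioBound_of_chart (Λ : Set S) (φ : S →+* T) (hdimT : ringKrullDim T = (3 : ℕ)) {x y z : S} {t Y : T}
    (h𝔪T : Ideal.span (Set.range ![t, φ z, Y]) = maximalIdeal T) (hres : ∀ w : T, ∃ c ∈ Λ, w - φ c ∈ maximalIdeal T)
    {b ν q r ρ : ℕ} (hx : φ x = t) (hy : φ y = t ^ b * Y) (hφ : Ideal.map φ (maximalIdeal S) ≤ maximalIdeal T)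
    (ht2 : t ∉ maximalIdeal T ^ 2) (hz : z ∈ maximalIdeal S) (hν : 0 < ν) (hρ : 0 < ρ) (hρq : ρ < q)
    (hr : r = q * b + ρ) {f : S} {f₁ : T} (hf₁ : φ f = t ^ (b * ν) * f₁) (hpers : f₁ ∈ maximalIdeal T ^ ν)
    (horacle : ∀ c : S, ∀ M : ℕ, ∃ (Δ : Finset (Fin 3 → ℕ)) (a : (Fin 3 → ℕ) → S), (∀ α ∈ Δ, IsUnit (a α)) ∧
      f - ∑ α ∈ Δ, a α * ∏ i, ![x, y - c * x ^ (b + 1), z] i ^ α i ∈ maximalIdeal S ^ M ∧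
      (∀ α ∈ Δ, b * ν ≤ α 0 + b * α 1 ∨ M ≤ α 2) ∧ (∀ α ∈ Δ, r * (ν - α 1) ≤ q * α 0 ∨ M ≤ α 2) ∧
      (![0, ν, 0] : Fin 3 → ℕ) ∈ Δ ∧
      ∃ α₀ ∈ Δ, r * (ν - α₀ 1) ≤ q * α₀ 0 ∧ q * α₀ 0 + α₀ 2 < (r + 1) * (ν - α₀ 1)) :
    OneFlagRatioBound T f₁ ν q ρ := by
  classical
  have hq : 0 < q := lt_of_le_of_lt (Nat.zero_le _) hρq
  -- the translated charts
  have hy' : ∀ c : S, φ (y - c * x ^ (b + 1)) = t ^ b * (Y - φ c * t) := by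
    intro c
    rw [map_sub, map_mul, map_pow, hx, hy]
    ring
  -- (D2) layer data from the oracle at `c = 0`
  obtain ⟨Δ₀, a₀, hunit₀, hrem₀, hcyl₀, hprep₀, hyν₀, -⟩ := horacle 0 (ν + 1 + b * ν)
  have hrem₀' : f - ∑ α ∈ Δ₀, a₀ α * ∏ i, ![x, y, z] i ^ α i ∈ maximalIdeal S ^ (ν + 1 + b * ν) := by
    simpa using hrem₀
  obtain ⟨ΔT, aT, hΔ, hα₀, ha₀, htfree, hf⟩ := layerData_of_chart φ hdimT h𝔪T hx hy hφ ht2 hz hρ hr hunit₀ hrem₀'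
    le_rfl hcyl₀ hprep₀ hyν₀ hf₁ hpers
  refine oneFlagRatioBound_of_lowWitnesses (φ '' Λ) ?_ hdimT h𝔪T hν hρ hρq hΔ hα₀ ha₀ htfree hf ?_
  · intro w
    obtain ⟨c, hc, hw⟩ := hres w
    exact ⟨φ c, ⟨c, hc, rfl⟩, hw⟩
  · rintro _ ⟨c, hc, rfl⟩ A B hB hK h2
    obtain ⟨Δ, a, hunit, hrem, hcyl, hprep, -, α₀, hα₀Δ, hprep₀, hwit₀⟩ := horacle c (A * ν + b * ν)
    exact lowWitness_of_chart_of_deep φ hx (hy' c) hφ ht2 hz hq hr hunit hrem le_rfl hcyl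
      (by simpa [map_mul, map_pow, hx] using hf₁) hα₀Δ hprep₀ hwit₀

/-- The two-flag (`σ₁`) form of `oneFlagRatioBound_of_chart` (kept under its name of record). [folklore] -/
theorem successorRatioBound_of_chart (Λ : Set S) (φ : S →+* T) (hdimT : ringKrullDim T = (3 : ℕ)) {x y z : S} {t Y : T}
    (h𝔪T : Ideal.span (Set.range ![t, φ z, Y]) = maximalIdeal T) (hres : ∀ w : T, ∃ c ∈ Λ, w - φ c ∈ maximalIdeal T)
    {b ν q r ρ : ℕ} (hx : φ x = t) (hy : φ y = t ^ b * Y) (hφ : Ideal.map φ (maximalIdeal S) ≤ maximalIdeal T)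
    (ht2 : t ∉ maximalIdeal T ^ 2) (hz : z ∈ maximalIdeal S) (hν : 0 < ν) (hρ : 0 < ρ) (hρq : ρ < q)
    (hr : r = q * b + ρ) {f : S} {f₁ : T} (hf₁ : φ f = t ^ (b * ν) * f₁) (hpers : f₁ ∈ maximalIdeal T ^ ν)
    (horacle : ∀ c : S, ∀ M : ℕ, ∃ (Δ : Finset (Fin 3 → ℕ)) (a : (Fin 3 → ℕ) → S), (∀ α ∈ Δ, IsUnit (a α)) ∧
      f - ∑ α ∈ Δ, a α * ∏ i, ![x, y - c * x ^ (b + 1), z] i ^ α i ∈ maximalIdeal S ^ M ∧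
      (∀ α ∈ Δ, b * ν ≤ α 0 + b * α 1 ∨ M ≤ α 2) ∧ (∀ α ∈ Δ, r * (ν - α 1) ≤ q * α 0 ∨ M ≤ α 2) ∧
      (![0, ν, 0] : Fin 3 → ℕ) ∈ Δ ∧
      ∃ α₀ ∈ Δ, r * (ν - α₀ 1) ≤ q * α₀ 0 ∧ q * α₀ 0 + α₀ 2 < (r + 1) * (ν - α₀ 1)) :
    SuccessorRatioBound T f₁ ν q ρ :=
  (oneFlagRatioBound_of_chart Λ φ hdimT h𝔪T hres hx hy hφ ht2 hz hν hρ hρq hr hf₁ hpers horacle).successorRatioBound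

end ChartPullback

end RatContact

end Iota3

end Summit.ResolutionOfSingularities.ResolutionOfSingularities.Cruxes.HypersurfaceCentreConstruction.LocalEngine
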